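import Mathlib
import Summits.CriticalPhenomena.PercolationContinuityZ3.Theorems.PercNearOneGluingNoHeavyLowerTailStarSetForestCertificateTools
import HarnessLib

/-!
# `NoHeavyLowerTail` (stmt-CriticalPhenomena-4575) — the TRIANGLE certificate, algebraic core

Support file (prover `prim-gen-swap` gen 8; `--supports stmt-CriticalPhenomena-4575`).  No definitions, no named facts, no sorries; Mathlib only
(plus the cylinder sums of …StarSetForestCertificateTools).

Three two-port star CLASSES `i : Fin 3` on a TRIANGLE of ports; the class opposite port `d` is the class `d` (its ports are the two indices `≠ d`).
Class `i` is open with probability `θ_i`, independently; pattern weights `W(σ) = Π_{i∈σ}θ_i Π_{i∉σ}(1−θ_i)`.  Pointwise data (as in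
`StarSet.forestCertificate_core`): `g(σ)` (is `c` light), `sp d σ` (is port `d` light), `ℓ(σ)` (lonely indicator of the comonotone word, supported on
singletons), `lt d` (port `d` light in the frozen relay side), and two numbers: the hair budget `κ ≥ 0` and `chi ∈ {0,1}` (is `c` light and isolated from the
ports).  The hypotheses are the event inclusions of the seat memo TRIANGLE-PROOF.md §4 (F1)–(F3) and the trichotomy on the position of `c`
(heavy / light-isolated / glued to one port `r`).  CONCLUSION (`StarSet.triangleCertificate_core`): with the explicit two-regime weights
`x_d = (1−θ_d)/(3 − S)` if `S := Σθ ≤ 2`, `x_d = 1/2` if `S > 2` (then `κ ≥ 1/2` is required, cf. `StarSet.triangle_hair_budget`),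
`Σ_d x_d Σ_σ W(σ)(g(σ) − sp_d(σ)) ≤ Σ_σ W(σ)(g(σ) − ℓ(σ)) + κ·chi`.
-/

namespace Summit.CriticalPhenomena.PercolationContinuityZ3.Theorems

open Finset
open scoped BigOperators

namespace StarSet

/-- The three singletons and the empty pattern of `Fin 3`, as an explicit family. [folklore] -/
theorem mem_smallPatterns_iff (σ : Finset (Fin 3)) :
    σ ∈ ({∅, {0}, {1}, {2}} : Finset (Finset (Fin 3))) ↔ σ = ∅ ∨ ∃ i, σ = {i} := by
  constructor
  · intro h
    simp only [mem_insert, mem_singleton] at h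
    rcases h with h | h | h | h
    · exact Or.inl h
    · exact Or.inr ⟨0, h⟩
    · exact Or.inr ⟨1, h⟩
    · exact Or.inr ⟨2, h⟩
  · rintro (h | ⟨i, rfl⟩)
    · simp [h]
    · fin_cases i <;> simp

/-- **Triangle certificate, algebraic core.**  See the file header for the notation and the hypotheses. [this file; TRIANGLE-PROOF.md §3–§5] -/
theorem triangleCertificate_core (θ : Fin 3 → ℝ) (hθ0 : ∀ i, 0 ≤ θ i) (hθ1 : ∀ i, θ i ≤ 1)
    (g ℓ : Finset (Fin 3) → ℝ) (sp : Fin 3 → Finset (Fin 3) → ℝ) (lt : Fin 3 → Prop) (chi κ : ℝ)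
    (hsp0 : ∀ d σ, 0 ≤ sp d σ)
    (hℓ0 : ∀ σ : Finset (Fin 3), (∀ i, σ ≠ {i}) → ℓ σ = 0) (hℓnn : ∀ i, 0 ≤ ℓ {i}) (hℓ1 : ∀ i, ℓ {i} ≤ 1)
    (hLlt : ∀ i, ℓ {i} ≠ 0 → ∀ j, j ≠ i → lt j)
    (hlt : ∀ d, lt d → ∀ σ : Finset (Fin 3), σ ⊆ {d} → sp d σ = 1)
    (hLsp : ∀ i, ℓ {i} ≠ 0 → ∀ j, j ≠ i → sp j {i} = 1)
    (hchi0 : 0 ≤ chi) (hκ0 : 0 ≤ κ) (hκ : 2 < ∑ i, θ i → 1 / 2 ≤ κ)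
    (hc : (∀ σ, g σ = 0) ∨ ((∀ σ, g σ = 1) ∧ chi = 1) ∨
      (∃ r, (∀ σ, g σ = if σ ⊆ {r} then 1 else 0) ∧ (∀ σ, sp r σ = g σ) ∧ (∀ i, i ≠ r → ℓ {i} = 0))) :
    ∑ d, (if ∑ i, θ i ≤ 2 then (1 - θ d) / (3 - ∑ i, θ i) else 1 / 2) *
        ∑ σ ∈ (univ : Finset (Fin 3)).powerset, ((∏ i ∈ σ, θ i) * ∏ i ∈ univ \ σ, (1 - θ i)) * (g σ - sp d σ) ≤
      (∑ σ ∈ (univ : Finset (Fin 3)).powerset, ((∏ i ∈ σ, θ i) * ∏ i ∈ univ \ σ, (1 - θ i)) * (g σ - ℓ σ)) + κ * chi := by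
  set W : Finset (Fin 3) → ℝ := fun σ => (∏ i ∈ σ, θ i) * ∏ i ∈ univ \ σ, (1 - θ i) with hW
  set S : ℝ := ∑ i, θ i with hS
  set x : Fin 3 → ℝ := fun d => if S ≤ 2 then (1 - θ d) / (3 - S) else 1 / 2 with hx
  set P : Finset (Finset (Fin 3)) := (univ : Finset (Fin 3)).powerset with hP
  have hWnn : ∀ σ, 0 ≤ W σ := fun σ => mul_nonneg (prod_nonneg fun i _ => hθ0 i) (prod_nonneg fun i _ => sub_nonneg.2 (hθ1 i))
  have hS3 : S ≤ 3 := by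
    have : ∑ i, θ i ≤ ∑ _i : Fin 3, (1 : ℝ) := sum_le_sum fun i _ => hθ1 i
    simpa using this
  have hS0 : 0 ≤ S := sum_nonneg fun i _ => hθ0 i
  -- the explicit weights of the certificate
  have hxnn : ∀ d, 0 ≤ x d := by
    intro d; simp only [hx]
    split_ifs with h
    · exact div_nonneg (sub_nonneg.2 (hθ1 d)) (by linarith)
    · norm_num
  -- Z = Π(1−θ), Z_d = Π_{j≠d}(1−θ_j) = W ∅ + W {d}, W {i} = θ_i Z_i
  set Z : ℝ := ∏ i, (1 - θ i) with hZ
  set Zd : Fin 3 → ℝ := fun d => ∏ j ∈ univ.erase d, (1 - θ j) with hZd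
  have hZdnn : ∀ d, 0 ≤ Zd d := fun d => prod_nonneg fun j _ => sub_nonneg.2 (hθ1 j)
  have hWempty : W ∅ = Z := by simp [hW, hZ]
  have hWsing : ∀ i, W {i} = θ i * Zd i := by
    intro i
    simp only [hW, hZd, prod_singleton]
    congr 1
    congr 1
    ext j; simp [mem_erase, eq_comm]
  have hZsplit : ∀ d, Z = (1 - θ d) * Zd d := by
    intro d
    rw [hZ, hZd, ← mul_prod_erase univ (fun j => 1 - θ j) (mem_univ d)]
  have hZd_eq : ∀ d, W ∅ + W {d} = Zd d := by
    intro d; rw [hWempty, hWsing, hZsplit d]; ring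
  -- total mass
  have hsumW : ∑ σ ∈ P, W σ = 1 := by
    have h := cylinder_sum_closed θ (∅ : Finset (Fin 3))
    simp only [notMem_empty, IsEmpty.forall_iff, implies_true, if_true, mul_one, prod_empty] at h
    exact h
  -- c glued to a port r: the mass of the patterns avoiding the classes at r
  have hsum_sub : ∀ r, ∑ σ ∈ P, W σ * (if σ ⊆ {r} then (1 : ℝ) else 0) = Zd r := by
    intro r
    have h := cylinder_sum_closed θ (univ.erase r)
    simp only [hZd]
    rw [← h]
    refine sum_congr rfl fun σ _ => ?_
    congr 1
    by_cases hσ : σ ⊆ {r}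
    · rw [if_pos hσ, if_pos]
      intro k hk hkσ
      exact (mem_erase.1 hk).1 (mem_singleton.1 (hσ hkσ))
    · rw [if_neg hσ, if_neg]
      intro hk
      apply hσ
      intro j hj
      rw [mem_singleton]
      by_contra hne
      exact hk j (mem_erase.2 ⟨hne, mem_univ _⟩) hj
  -- the lonely mass: Σ_σ W σ ℓ σ = Σ_i W{i} ℓ{i}
  set T : Finset (Finset (Fin 3)) := {∅, {0}, {1}, {2}} with hT
  have hTP : T ⊆ P := fun σ _ => mem_powerset.2 (subset_univ _)
  have hℓsum : ∑ σ ∈ P, W σ * ℓ σ = ∑ i, W {i} * ℓ {i} := by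
    have h1 : ∑ σ ∈ P, W σ * ℓ σ = ∑ σ ∈ T, W σ * ℓ σ := by
      symm
      refine sum_subset hTP fun σ _ hσT => ?_
      rw [hℓ0 σ (fun i h => hσT ((mem_smallPatterns_iff σ).2 (Or.inr ⟨i, h⟩))), mul_zero]
    rw [h1, hT]
    rw [sum_insert (by decide), sum_insert (by decide), sum_insert (by decide), sum_singleton]
    rw [hℓ0 ∅ (fun i h => by have := h ▸ mem_singleton_self i; simp at this), mul_zero, zero_add]
    rw [Fin.sum_univ_three]
    ring
  -- lower bound for R_d: the four small patterns
  have hRlow : ∀ d, W ∅ * sp d ∅ + W {0} * sp d {0} + W {1} * sp d {1} + W {2} * sp d {2} ≤ ∑ σ ∈ P, W σ * sp d σ := by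
    intro d
    have h := sum_le_sum_of_subset_of_nonneg hTP (f := fun σ => W σ * sp d σ)
      (fun σ _ _ => mul_nonneg (hWnn σ) (hsp0 d σ))
    rw [hT, sum_insert (by decide), sum_insert (by decide), sum_insert (by decide), sum_singleton] at h
    linarith
  -- per-port facts: (a) the class-`i` singleton pays port `d ≠ i` at least `W{i} ℓ{i}`
  have hpay : ∀ d i, i ≠ d → W {i} * ℓ {i} ≤ W {i} * sp d {i} := by
    intro d i hid
    by_cases h : ℓ {i} = 0
    · rw [h, mul_zero]; exact mul_nonneg (hWnn _) (hsp0 _ _)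
    · rw [hLsp i h d (Ne.symm hid)]; exact mul_le_mul_of_nonneg_left (hℓ1 i) (hWnn _)
  -- (b) if a class `i ≠ d` is lonely-capable then port `d` is light on `σ ⊆ {d}`: budget `Zd d`
  have hbase : ∀ d i, i ≠ d → Zd d * ℓ {i} ≤ W ∅ * sp d ∅ + W {d} * sp d {d} := by
    intro d i hid
    by_cases h : ℓ {i} = 0
    · rw [h, mul_zero]; exact add_nonneg (mul_nonneg (hWnn _) (hsp0 _ _)) (mul_nonneg (hWnn _) (hsp0 _ _))
    · have hl := hLlt i h d (Ne.symm hid)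
      rw [hlt d hl ∅ (empty_subset _), hlt d hl {d} (subset_refl _), mul_one, mul_one, hZd_eq]
      exact mul_le_of_le_one_right (hZdnn d) (hℓ1 i)
  -- R_d and G abbreviations
  set R : Fin 3 → ℝ := fun d => ∑ σ ∈ P, W σ * sp d σ with hR
  set G : ℝ := ∑ σ ∈ P, W σ * g σ with hG
  set L : ℝ := ∑ i, W {i} * ℓ {i} with hL
  have hLHS : ∀ d, ∑ σ ∈ P, W σ * (g σ - sp d σ) = G - R d := by
    intro d
    have : ∑ σ ∈ P, W σ * (g σ - sp d σ) = (∑ σ ∈ P, W σ * g σ) - ∑ σ ∈ P, W σ * sp d σ := by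
      rw [← sum_sub_distrib]; exact sum_congr rfl fun σ _ => by ring
    rw [this]
  have hRHS : ∑ σ ∈ P, W σ * (g σ - ℓ σ) = G - L := by
    have : ∑ σ ∈ P, W σ * (g σ - ℓ σ) = (∑ σ ∈ P, W σ * g σ) - ∑ σ ∈ P, W σ * ℓ σ := by
      rw [← sum_sub_distrib]; exact sum_congr rfl fun σ _ => by ring
    rw [this, hℓsum]
  have hgoal : ∑ d, x d * ∑ σ ∈ P, W σ * (g σ - sp d σ) = ∑ d, x d * (G - R d) :=
    sum_congr rfl fun d _ => by rw [hLHS d]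
  change ∑ d, x d * ∑ σ ∈ P, W σ * (g σ - sp d σ) ≤ (∑ σ ∈ P, W σ * (g σ - ℓ σ)) + κ * chi
  rw [hgoal, hRHS]
  -- KEY port-side inequality: L ≤ Σ_d x_d R_d, in both regimes
  have hkey : L ≤ ∑ d, x d * R d := by
    -- R_d ≥ Zd d · (ℓ_i + ℓ_i')/2-type base + the two singleton payments; we use explicit indices
    have hR0 : Zd 0 * ℓ {1} ≤ R 0 ∧ Zd 0 * ℓ {2} ≤ R 0 ∧ W {1} * ℓ {1} + W {2} * ℓ {2} + Zd 0 * ℓ {1} ≤ R 0 ∧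
        W {1} * ℓ {1} + W {2} * ℓ {2} + Zd 0 * ℓ {2} ≤ R 0 := by
      have h := hRlow 0
      have p1 := hpay 0 1 (by decide); have p2 := hpay 0 2 (by decide)
      have b1 := hbase 0 1 (by decide); have b2 := hbase 0 2 (by decide)
      have n0 : 0 ≤ W {0} * sp 0 {0} := mul_nonneg (hWnn _) (hsp0 _ _)
      have nE : 0 ≤ W ∅ * sp 0 ∅ := mul_nonneg (hWnn _) (hsp0 _ _)
      have n1 : 0 ≤ W {1} * ℓ {1} := mul_nonneg (hWnn _) (hℓnn _)
      have n2 : 0 ≤ W {2} * ℓ {2} := mul_nonneg (hWnn _) (hℓnn _)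
      refine ⟨by linarith, by linarith, by linarith, by linarith⟩
    have hR1 : Zd 1 * ℓ {0} ≤ R 1 ∧ Zd 1 * ℓ {2} ≤ R 1 ∧ W {0} * ℓ {0} + W {2} * ℓ {2} + Zd 1 * ℓ {0} ≤ R 1 ∧
        W {0} * ℓ {0} + W {2} * ℓ {2} + Zd 1 * ℓ {2} ≤ R 1 := by
      have h := hRlow 1
      have p1 := hpay 1 0 (by decide); have p2 := hpay 1 2 (by decide)
      have b1 := hbase 1 0 (by decide); have b2 := hbase 1 2 (by decide)
      have n0 : 0 ≤ W {1} * sp 1 {1} := mul_nonneg (hWnn _) (hsp0 _ _)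
      have nE : 0 ≤ W ∅ * sp 1 ∅ := mul_nonneg (hWnn _) (hsp0 _ _)
      have n1 : 0 ≤ W {0} * ℓ {0} := mul_nonneg (hWnn _) (hℓnn _)
      have n2 : 0 ≤ W {2} * ℓ {2} := mul_nonneg (hWnn _) (hℓnn _)
      refine ⟨by linarith, by linarith, by linarith, by linarith⟩
    have hR2 : Zd 2 * ℓ {0} ≤ R 2 ∧ Zd 2 * ℓ {1} ≤ R 2 ∧ W {0} * ℓ {0} + W {1} * ℓ {1} + Zd 2 * ℓ {0} ≤ R 2 ∧
        W {0} * ℓ {0} + W {1} * ℓ {1} + Zd 2 * ℓ {1} ≤ R 2 := by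
      have h := hRlow 2
      have p1 := hpay 2 0 (by decide); have p2 := hpay 2 1 (by decide)
      have b1 := hbase 2 0 (by decide); have b2 := hbase 2 1 (by decide)
      have n0 : 0 ≤ W {2} * sp 2 {2} := mul_nonneg (hWnn _) (hsp0 _ _)
      have nE : 0 ≤ W ∅ * sp 2 ∅ := mul_nonneg (hWnn _) (hsp0 _ _)
      have n1 : 0 ≤ W {0} * ℓ {0} := mul_nonneg (hWnn _) (hℓnn _)
      have n2 : 0 ≤ W {1} * ℓ {1} := mul_nonneg (hWnn _) (hℓnn _)
      refine ⟨by linarith, by linarith, by linarith, by linarith⟩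
    -- numeric data
    have hW0 := hWsing 0; have hW1 := hWsing 1; have hW2 := hWsing 2
    have hZ0 := hZsplit 0; have hZ1 := hZsplit 1; have hZ2 := hZsplit 2
    have hl0 := hℓnn 0; have hl1 := hℓnn 1; have hl2 := hℓnn 2
    have hl0' := hℓ1 0; have hl1' := hℓ1 1; have hl2' := hℓ1 2
    have ht0 := hθ0 0; have ht1 := hθ0 1; have ht2 := hθ0 2
    have ht0' := hθ1 0; have ht1' := hθ1 1; have ht2' := hθ1 2
    have hZd0 := hZdnn 0; have hZd1 := hZdnn 1; have hZd2 := hZdnn 2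
    have hS' : S = θ 0 + θ 1 + θ 2 := by rw [hS, Fin.sum_univ_three]
    rw [Fin.sum_univ_three]
    rw [hL, Fin.sum_univ_three]
    by_cases hreg : S ≤ 2
    · -- regime S ≤ 2: x_d = (1 − θ_d)/(3 − S)
      have hE : 0 < 3 - S := by linarith
      have hx0 : x 0 = (1 - θ 0) / (3 - S) := by simp only [hx, if_pos hreg]
      have hx1 : x 1 = (1 - θ 1) / (3 - S) := by simp only [hx, if_pos hreg]
      have hx2 : x 2 = (1 - θ 2) / (3 - S) := by simp only [hx, if_pos hreg]
      -- use R_d ≥ (singleton payments) + Zd d·(ℓ_i + ℓ_i')/2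
      have hRb0 : W {1} * ℓ {1} + W {2} * ℓ {2} + Zd 0 * (ℓ {1} + ℓ {2}) / 2 ≤ R 0 := by
        rcases hR0 with ⟨-, -, a, b⟩; linarith
      have hRb1 : W {0} * ℓ {0} + W {2} * ℓ {2} + Zd 1 * (ℓ {0} + ℓ {2}) / 2 ≤ R 1 := by
        rcases hR1 with ⟨-, -, a, b⟩; linarith
      have hRb2 : W {0} * ℓ {0} + W {1} * ℓ {1} + Zd 2 * (ℓ {0} + ℓ {1}) / 2 ≤ R 2 := by
        rcases hR2 with ⟨-, -, a, b⟩; linarith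
      have hx0nn := hxnn 0; have hx1nn := hxnn 1; have hx2nn := hxnn 2
      have step : x 0 * (W {1} * ℓ {1} + W {2} * ℓ {2} + Zd 0 * (ℓ {1} + ℓ {2}) / 2) +
          x 1 * (W {0} * ℓ {0} + W {2} * ℓ {2} + Zd 1 * (ℓ {0} + ℓ {2}) / 2) +
          x 2 * (W {0} * ℓ {0} + W {1} * ℓ {1} + Zd 2 * (ℓ {0} + ℓ {1}) / 2) ≤
          x 0 * R 0 + x 1 * R 1 + x 2 * R 2 := by
        have := mul_le_mul_of_nonneg_left hRb0 hx0nn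
        have := mul_le_mul_of_nonneg_left hRb1 hx1nn
        have := mul_le_mul_of_nonneg_left hRb2 hx2nn
        linarith
      refine le_trans ?_ step
      -- algebra: with x_d (1−θ_d)... everything in terms of Z, θ, ℓ
      -- x_d * Zd d = Z/(3−S);  x_j + x_k = 1 − (1−θ_i)/(3−S);  W{i}(1−θ_i) = θ_i Z
      have hxZ0 : (1 - θ 0) * Zd 0 = Z := (hZsplit 0).symm
      have hxZ1 : (1 - θ 1) * Zd 1 = Z := (hZsplit 1).symm
      have hxZ2 : (1 - θ 2) * Zd 2 = Z := (hZsplit 2).symm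
      rw [hx0, hx1, hx2]
      rw [hW0, hW1, hW2]
      -- clear denominators: RHS = (Σ_d (1−θ_d)·A_d)/(3−S)
      rw [div_mul_eq_mul_div, div_mul_eq_mul_div, div_mul_eq_mul_div, ← add_div, ← add_div, le_div_iff₀ hE]
      rw [hS'] 
      have hZnn : 0 ≤ Z := by rw [hZ0]; exact mul_nonneg (sub_nonneg.2 ht0') hZd0
      -- the products (1−θ_d)·Zd_d collapse to Z
      have f0 : (1 - θ 0) * (Zd 0 * (ℓ {1} + ℓ {2}) / 2) = Z * (ℓ {1} + ℓ {2}) / 2 := by rw [← hxZ0]; ring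
      have f1 : (1 - θ 1) * (Zd 1 * (ℓ {0} + ℓ {2}) / 2) = Z * (ℓ {0} + ℓ {2}) / 2 := by rw [← hxZ1]; ring
      have f2 : (1 - θ 2) * (Zd 2 * (ℓ {0} + ℓ {1}) / 2) = Z * (ℓ {0} + ℓ {1}) / 2 := by rw [← hxZ2]; ring
      have g0 : θ 0 * Zd 0 * ℓ {0} * (1 - θ 0) = Z * (θ 0 * ℓ {0}) := by rw [← hxZ0]; ring
      have g1 : θ 1 * Zd 1 * ℓ {1} * (1 - θ 1) = Z * (θ 1 * ℓ {1}) := by rw [← hxZ1]; ring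
      have g2 : θ 2 * Zd 2 * ℓ {2} * (1 - θ 2) = Z * (θ 2 * ℓ {2}) := by rw [← hxZ2]; ring
      have k0 : Z * (θ 0 * ℓ {0}) ≤ Z * ℓ {0} := mul_le_mul_of_nonneg_left (mul_le_of_le_one_left hl0 ht0') hZnn
      have k1 : Z * (θ 1 * ℓ {1}) ≤ Z * ℓ {1} := mul_le_mul_of_nonneg_left (mul_le_of_le_one_left hl1 ht1') hZnn
      have k2 : Z * (θ 2 * ℓ {2}) ≤ Z * ℓ {2} := mul_le_mul_of_nonneg_left (mul_le_of_le_one_left hl2 ht2') hZnn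
      linarith [f0, f1, f2, g0, g1, g2, k0, k1, k2]
    · -- regime S > 2: x ≡ 1/2
      have hx0 : x 0 = 1 / 2 := by simp only [hx, if_neg hreg]
      have hx1 : x 1 = 1 / 2 := by simp only [hx, if_neg hreg]
      have hx2 : x 2 = 1 / 2 := by simp only [hx, if_neg hreg]
      rw [hx0, hx1, hx2]
      rcases hR0 with ⟨-, -, a0, -⟩
      rcases hR1 with ⟨-, -, a1, -⟩
      rcases hR2 with ⟨-, -, a2, -⟩
      have n1 : 0 ≤ Zd 0 * ℓ {1} := mul_nonneg hZd0 hl1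
      have n2 : 0 ≤ Zd 1 * ℓ {0} := mul_nonneg hZd1 hl0
      have n3 : 0 ≤ Zd 2 * ℓ {0} := mul_nonneg hZd2 hl0
      linarith
  -- total weight of the certificate
  have hX : ∑ d, x d ≤ 1 + κ ∧ (∑ i, θ i ≤ 2 → ∑ d, x d = 1) := by
    constructor
    · rw [Fin.sum_univ_three]
      by_cases hreg : S ≤ 2
      · have hE : 0 < 3 - S := by linarith
        have : x 0 + x 1 + x 2 = 1 := by
          simp only [hx, if_pos hreg]
          rw [← add_div, ← add_div, div_eq_one_iff_eq (ne_of_gt hE), hS, Fin.sum_univ_three]; ring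
        linarith
      · push Not at hreg
        have hk := hκ (show 2 < S from hreg)
        simp only [hx, if_neg (not_le.2 hreg)]
        linarith
    · intro hreg
      rw [Fin.sum_univ_three]
      have hreg' : S ≤ 2 := hreg
      have hE : 0 < 3 - S := by linarith
      simp only [hx, if_pos hreg']
      rw [← add_div, ← add_div, div_eq_one_iff_eq (ne_of_gt hE), hS, Fin.sum_univ_three]; ring
  -- pair sums are at most 1
  have hpair : ∀ r, ∑ d ∈ univ.erase r, x d ≤ 1 := by
    intro r
    by_cases hreg : S ≤ 2
    · have h1 := hX.2 hreg
      rw [← Finset.add_sum_erase univ x (mem_univ r)] at h1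
      linarith [hxnn r]
    · have : ∀ d, x d = 1 / 2 := fun d => by simp only [hx, if_neg hreg]
      simp only [this, sum_const, card_erase_of_mem (mem_univ r), card_univ, Fintype.card_fin, nsmul_eq_mul]
      norm_num
  -- the three cases for c
  rcases hc with hheavy | ⟨hiso, hchi⟩ | ⟨r, hgr, hspr, hℓr⟩
  · -- (i) c heavy: G = 0
    have hG0 : G = 0 := by rw [hG]; simp [hheavy]
    rw [hG0]
    have : ∑ d, x d * (0 - R d) = -(∑ d, x d * R d) := by rw [← sum_neg_distrib]; exact sum_congr rfl fun d _ => by ring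
    rw [this]
    nlinarith [hkey, mul_nonneg hκ0 hchi0]
  · -- (ii) c light and isolated: G = 1, chi = 1
    have hG1 : G = 1 := by rw [hG]; simp only [hiso, mul_one]; exact hsumW
    rw [hG1, hchi, mul_one]
    have : ∑ d, x d * (1 - R d) = (∑ d, x d) - ∑ d, x d * R d := by
      rw [← sum_sub_distrib]; exact sum_congr rfl fun d _ => by ring
    rw [this]
    linarith [hkey, hX.1]
  · -- (iii) c glued to port r: G = Zd r = R r; only class r can be lonely
    have hGr : G = Zd r := by rw [hG, ← hsum_sub r]; exact sum_congr rfl fun σ _ => by rw [hgr σ]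
    have hRr : R r = G := by rw [hR, hG]; exact sum_congr rfl fun σ _ => by rw [hspr σ]
    -- L = W{r} ℓ{r}
    have hLr : L = W {r} * ℓ {r} := by
      rw [hL, ← Finset.add_sum_erase univ (fun i => W {i} * ℓ {i}) (mem_univ r)]
      rw [sum_eq_zero (fun i hi => by rw [hℓr i (mem_erase.1 hi).1, mul_zero]), add_zero]
    -- R_d ≥ Zd r · ℓ{r} for d ≠ r
    have hRd : ∀ d, d ≠ r → Zd r * ℓ {r} ≤ R d := by
      intro d hdr
      by_cases h : ℓ {r} = 0
      · rw [h, mul_zero]; exact sum_nonneg fun σ _ => mul_nonneg (hWnn σ) (hsp0 d σ)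
      · have hl := hLlt r h d hdr
        have h1 : sp d ∅ = 1 := hlt d hl ∅ (empty_subset _)
        have h2 : sp d {r} = 1 := hLsp r h d hdr
        have hsub : ({∅, {r}} : Finset (Finset (Fin 3))) ⊆ P := fun σ _ => mem_powerset.2 (subset_univ _)
        have hle := sum_le_sum_of_subset_of_nonneg hsub (f := fun σ => W σ * sp d σ) (fun σ _ _ => mul_nonneg (hWnn σ) (hsp0 d σ))
        rw [sum_insert (by simp), sum_singleton, h1, h2, mul_one, mul_one, hZd_eq] at hle
        exact le_trans (mul_le_of_le_one_right (hZdnn r) (hℓ1 r)) hle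
    -- split the d-sum at r
    rw [← Finset.add_sum_erase univ (fun d => x d * (G - R d)) (mem_univ r)]
    simp only [hRr, sub_self, mul_zero, zero_add]
    have hrest : ∑ d ∈ univ.erase r, x d * (G - R d) ≤ (∑ d ∈ univ.erase r, x d) * (Zd r * (1 - ℓ {r})) := by
      rw [sum_mul]
      refine sum_le_sum fun d hd => ?_
      have hdr : d ≠ r := (mem_erase.1 hd).1
      have := hRd d hdr
      have : G - R d ≤ Zd r * (1 - ℓ {r}) := by rw [hGr]; linarith
      exact mul_le_mul_of_nonneg_left this (hxnn d)
    refine le_trans hrest ?_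
    rw [hLr, hGr, hWsing r]
    have hs := hpair r
    have hsnn : 0 ≤ ∑ d ∈ univ.erase r, x d := sum_nonneg fun d _ => hxnn d
    nlinarith [hZdnn r, hℓnn r, hℓ1 r, hθ0 r, hθ1 r, mul_nonneg hκ0 hchi0,
      mul_nonneg (hZdnn r) (sub_nonneg.2 (hℓ1 r)), mul_nonneg (mul_nonneg (hZdnn r) (hℓnn r)) (sub_nonneg.2 (hθ1 r))]

end StarSet

end Summit.CriticalPhenomena.PercolationContinuityZ3.Theorems
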